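import Literature.Algebra.EuclideanLattices.AdjugateMachine
import Literature.Algebra.EuclideanLattices.FarCertMachine
import Literature.Algebra.EuclideanLattices.LLLMachineMain
import Literature.Computability.Complexity.RatBricks
import HarnessLib

/-!
# Regev 2009, Lemma 3.20: the `DGS` query `((adj(−B))ᵀ, |det B|/(100 d))` is computed in polynomial time

Topic `Algebra/EuclideanLattices` (family `pqc`). Machine-level piece of the machine form of
**Lemma 3.20** of Regev 2009 (hypothesis `hL` of
`Literature.Computability.Cryptography.regev_lwe_to_gapSVP_quantum_of_dgs`): the reduction
"calls the `DGS` oracle … with the lattice `L*` and the value `1/(100 d)`" (author's version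
arXiv:2401.03703, p. 22). The tree's `DGS` samplers take INTEGER instances
(`UniformQCircuitFamily.SamplesDGS`, `Cryptography/RegevDGSReduction.lean`), so the query is the
scaled dual `det B · L(B)* = L((adj B)ᵀ)` at the scaled width `|det B|/(100 d)`
(`RegevDualQuery.lean`: `adjDual`, `adjDualLattice_eq_smul`, `discreteGaussian_adjDualLattice_map_val`);
up to the harmless sign `adj(−B) = ± adj B` (same lattice) this is what the Faddeev–LeVerrier
machine of `AdjugateMachine.lean` delivers. This file assembles the **query writer**

  `queryF : code of ((B, t), d) ↦ code of (⟨n, (adj(−B))ᵀ⟩, |det(−B)| · den(d) / (100 · |num(d)|))`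

as a total string function in `FP` (`queryF_mem_FP`) with its value on every instance code with
`d ≠ 0` (`queryF_codeOf`): the pieces are the readers of `FarCertMachine.lean` (dimension, basis),
a quadratic yardstick `1^{4|x|² + 4}` (wide enough for the Faddeev–LeVerrier registers,
`widthOK_codeOf`), `adjNegF`, the instance writer `LLLMachine.outF` of `LLLMachineMain.lean` (which
re-codes a canonical matrix code into the row-major sign–magnitude instance format, given the code of an
instance of the same dimension — here `I.encode`, rebuilt from the fields of the `GapCVP` code, `iencW`),
and the lowest-terms rational code (`qnormF` of `RatBricks.lean`). Everything is proved; no named facts.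

## References

* O. Regev, *On lattices, learning with errors, random linear codes, and cryptography*, J. ACM 56
  (2009), art. 34; author's version arXiv:2401.03703, Lemma 3.20 and its proof (p. 22). [Regev2009]
* S. Arora, B. Barak, *Computational Complexity: A Modern Approach*, CUP 2009, §1.3, §0.1.
  [AroraBarak2009]
-/

noncomputable section

namespace Literature.Algebra.EuclideanLattices

open _root_.Computability Literature.Computability.Complexity Literature.Computability.Complexity.Brick Polynomial
open LLLMachine PRelSigPi OracleCompose FarCertMachine GMSS AdjMachine Plumb HashBricks Literature.LinearAlgebra.Matrix
open scoped Matrix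

namespace RegevQuery

/-! ### The yardstick and the width of the Faddeev–LeVerrier registers -/

/-- The quadratic yardstick polynomial `4X² + 4`. [folklore] -/
def yardPoly : Polynomial ℕ := 4 * X ^ 2 + 4

/-- The yardstick `1^{4|x|² + 4}` of an input `x`. [folklore] -/
def yardQ : List Bool → List Bool := polyFn yardPoly

/-- `yardQ ∈ FP`. [folklore] -/
theorem yardQ_mem_FP : yardQ ∈ FP := polyFn_mem_FP _

/-- Length of the yardstick. [folklore] -/
theorem length_yardQ (x : List Bool) : (yardQ x).length = 4 * x.length ^ 2 + 4 := by
  simp [yardQ, yardPoly]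

section Input

variable (I : LatticeInstance) (t : Fin I.n → ℤ) (d : ℚ)

/-- `n ≤ |x|` for the instance code `x`. [folklore] -/
theorem n_le_length_codeOf : I.n ≤ (codeOf I t d).length := (sizes_input I t d).1

/-- Entries of `B` are below `2^{|x|}`. [folklore] -/
theorem natAbs_basis_lt (i k : Fin I.n) : (I.basis i k).natAbs < 2 ^ (codeOf I t d).length :=
  Nat.size_le.1 ((FarCert.sizes_le_length_encode_gapCVP I t d).2.2.1 i k)

/-- `n² ≤ |x|`. [folklore] -/
theorem n_sq_le_length_codeOf : I.n * I.n ≤ (codeOf I t d).length := (sizes_input I t d).2.1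

/-- **The yardstick is wide enough**: no Faddeev–LeVerrier register saturates on the basis of an
instance (`n² b (2n²b)^{n-1} ≤ 2^{2L² + 3L} < 2^{4L² + 4}` with `b = 2^L`, `n² ≤ L = |x|`). [folklore] -/
theorem widthOK_codeOf : WidthOK (yardQ (codeOf I t d)).length I.basis := by
  set L := (codeOf I t d).length with hL
  have hb : ∀ i j, |I.basis i j| ≤ ((2 ^ L : ℕ) : ℤ) := fun i j => by
    have := natAbs_basis_lt I t d i j
    rw [← hL] at this
    rw [Int.abs_eq_natAbs]; exact_mod_cast this.le
  refine widthOK_of_bound I.basis hb (Nat.one_le_two_pow) ?_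
  have hn2 : I.n * I.n ≤ L := n_sq_le_length_codeOf I t d
  have hn : I.n ≤ L := (Nat.le_mul_self _).trans hn2
  have hL2 : L ≤ 2 ^ L := (Nat.lt_two_pow_self).le
  have hsq : I.n ^ 2 ≤ 2 ^ L := by rw [sq]; exact hn2.trans hL2
  -- `2 n² b ≤ 2^{2L+1}`
  have hK : 2 * I.n ^ 2 * 2 ^ L ≤ 2 ^ (2 * L + 1) := by
    calc 2 * I.n ^ 2 * 2 ^ L ≤ 2 * 2 ^ L * 2 ^ L := by gcongr
      _ = 2 ^ (2 * L + 1) := by rw [two_mul, pow_add, pow_succ]; ring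
  -- `n² b ≤ 2^{2L}`
  have hNb : I.n ^ 2 * 2 ^ L ≤ 2 ^ (2 * L) := by
    calc I.n ^ 2 * 2 ^ L ≤ 2 ^ L * 2 ^ L := by gcongr
      _ = 2 ^ (2 * L) := by rw [two_mul, pow_add]
  calc I.n ^ 2 * 2 ^ L * (2 * I.n ^ 2 * 2 ^ L) ^ (I.n - 1)
      ≤ 2 ^ (2 * L) * (2 ^ (2 * L + 1)) ^ (I.n - 1) := Nat.mul_le_mul hNb (Nat.pow_le_pow_left hK _)
    _ ≤ 2 ^ (2 * L) * (2 ^ (2 * L + 1)) ^ L := Nat.mul_le_mul_left _ (Nat.pow_le_pow_right (by positivity) (by omega))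
    _ = 2 ^ (2 * L + (2 * L + 1) * L) := by rw [← pow_mul, ← pow_add]
    _ < 2 ^ (yardQ (codeOf I t d)).length := by
        rw [length_yardQ, ← hL]
        exact Nat.pow_lt_pow_right (by norm_num) (by nlinarith)

end Input

/-! ### The pieces of the query writer (all on `w = ⟨x, y⟩`, `y` ignored) -/

/-- The yardstick of the instance part. [folklore] -/
def YF : List Bool → List Bool := yardQ ∘ fstF
/-- `⟨dpEnc det(−B), matCode (adj(−B))ᵀ⟩` by the Faddeev–LeVerrier machine. [folklore] -/
def adjF : List Bool → List Bool := adjNegF ∘ fanoutFn YF (fanoutFn ncW BnW)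
/-- The code `⟨bin n, ⟨1^{n²}, entries⟩⟩ = I.encode` of the basis part of the instance, rebuilt from the
first two fields of the `GapCVP` code (`iencW_input`). [folklore] -/
def iencW : List Bool → List Bool := fanoutFn ncW (fstF ∘ sndF ∘ fstF ∘ fstF)
/-- The instance code of `⟨n, (adj(−B))ᵀ⟩`: the instance writer `LLLMachine.outF` on `⟨I.encode, T⟩`.
[folklore] -/
def instTF : List Bool → List Bool := outF ∘ fanoutFn iencW (sndF ∘ adjF)
/-- The numerator `|det(−B)| · den(d)`. [folklore] -/
def numrF : List Bool → List Bool := zmulF ∘ fanoutFn (zabsF ∘ fstF ∘ adjF) (natZF ∘ denW)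
/-- The denominator `100 · |num(d)|`. [folklore] -/
def denrF : List Bool → List Bool := prodFn ∘ fanoutFn (fun _ => encodeNat 100) numW
/-- The lowest-terms code `qEnc r` of the width `r`. [folklore] -/
def rqF : List Bool → List Bool := qnormF ∘ fanoutFn numrF denrF
/-- The instance-format code of `r`: `⟨sign–magnitude num, bin den⟩`. [folklore] -/
def ratF : List Bool → List Bool := fanoutFn (signMagOfZF ∘ fstF ∘ rqF) (sndF ∘ rqF)
/-- **The query on `w = ⟨x, y⟩`**: `⟨code of ⟨n, (adj(−B))ᵀ⟩, rat⟩`. [cite: Regev2009, Lemma 3.20 (proof)] -/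
def queryW : List Bool → List Bool := fanoutFn instTF ratF
/-- **The query writer** on the instance code `x` alone. [cite: Regev2009, Lemma 3.20 (proof)] -/
def queryF : List Bool → List Bool := queryW ∘ fanoutFn (fun w => w) (fun _ => [])

/-- `YF ∈ FP`. [folklore] -/
theorem YF_mem_FP : YF ∈ FP := comp_mem_FP yardQ_mem_FP fstF_mem_FP
/-- `adjF ∈ FP`. [folklore] -/
theorem adjF_mem_FP : adjF ∈ FP := comp_mem_FP adjNegF_mem_FP (fanoutFn_mem_FP YF_mem_FP (fanoutFn_mem_FP ncW_mem_FP BnW_mem_FP))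
/-- `iencW ∈ FP`. [folklore] -/
theorem iencW_mem_FP : iencW ∈ FP :=
  fanoutFn_mem_FP ncW_mem_FP (comp_mem_FP fstF_mem_FP (comp_mem_FP sndF_mem_FP (comp_mem_FP fstF_mem_FP fstF_mem_FP)))
/-- `instTF ∈ FP`. [folklore] -/
theorem instTF_mem_FP : instTF ∈ FP :=
  comp_mem_FP outF_mem_FP (fanoutFn_mem_FP iencW_mem_FP (comp_mem_FP sndF_mem_FP adjF_mem_FP))
/-- `numrF ∈ FP`. [folklore] -/
theorem numrF_mem_FP : numrF ∈ FP :=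
  comp_mem_FP zmulF_mem_FP (fanoutFn_mem_FP (comp_mem_FP zabsF_mem_FP (comp_mem_FP fstF_mem_FP adjF_mem_FP))
    (comp_mem_FP natZF_mem_FP denW_mem_FP))
/-- `denrF ∈ FP`. [folklore] -/
theorem denrF_mem_FP : denrF ∈ FP := comp_mem_FP prodFn_mem_FP (fanoutFn_mem_FP (const_mem_FP _) numW_mem_FP)
/-- `rqF ∈ FP`. [folklore] -/
theorem rqF_mem_FP : rqF ∈ FP := comp_mem_FP qnormF_mem_FP (fanoutFn_mem_FP numrF_mem_FP denrF_mem_FP)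
/-- `ratF ∈ FP`. [folklore] -/
theorem ratF_mem_FP : ratF ∈ FP :=
  fanoutFn_mem_FP (comp_mem_FP signMagOfZF_mem_FP (comp_mem_FP fstF_mem_FP rqF_mem_FP)) (comp_mem_FP sndF_mem_FP rqF_mem_FP)
/-- `queryW ∈ FP`. [folklore] -/
theorem queryW_mem_FP : queryW ∈ FP :=
  fanoutFn_mem_FP instTF_mem_FP ratF_mem_FP
/-- **`queryF ∈ FP`.** [cite: AroraBarak2009, §1.3] -/
theorem queryF_mem_FP : queryF ∈ FP :=
  comp_mem_FP queryW_mem_FP (fanoutFn_mem_FP (PolyTimeComputable.id _) (const_mem_FP _))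

/-! ### The value on an instance code -/

section Value

variable (I : LatticeInstance) (t : Fin I.n → ℤ) (d : ℚ) (y : List Bool)

/-- The width of the query: `|det(−B)| · den(d) / (100 · |num(d)|)` (`= |det B| / (100 d)` for `d > 0`,
`queryWidth_eq`). [cite: Regev2009, Lemma 3.20 (proof)] -/
def queryWidth : ℚ := ((|(-I.basis).det| * (d.den : ℤ) : ℤ) : ℚ) / ((100 * d.num.natAbs : ℕ) : ℚ)

/-- The queried integer instance: `⟨n, (adj(−B))ᵀ⟩` (the instance `adjDual` of `RegevDualQuery.lean`
taken at `−B`, same lattice `det B · L(B)*`). [cite: Regev2009, Lemma 3.20 (proof)] -/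
def queryInstance : LatticeInstance := ⟨I.n, ((-I.basis).adjugate)ᵀ⟩

/-- For `d > 0` the width is Regev's `1/(100 d)` scaled by `|det B|`. [cite: Regev2009, Lemma 3.20 (proof)] -/
theorem queryWidth_eq (hd : 0 < d) : queryWidth I d = |(I.basis.det : ℚ)| / (100 * d) := by
  have hnum : 0 < d.num := Rat.num_pos.2 hd
  have hdet : |(-I.basis).det| = |I.basis.det| := by
    rw [Matrix.det_neg, abs_mul, abs_pow, abs_neg, abs_one, one_pow, one_mul]
  have hM : ((100 * d.num.natAbs : ℕ) : ℚ) = 100 * (d.num : ℚ) := by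
    rw [Nat.cast_mul, Nat.cast_natAbs, Int.cast_abs, abs_of_pos (by exact_mod_cast hnum : (0 : ℚ) < d.num)]
    norm_num
  have hZ : ((|(-I.basis).det| * (d.den : ℤ) : ℤ) : ℚ) = |(I.basis.det : ℚ)| * d.den := by
    rw [hdet, Int.cast_mul, Int.cast_abs, Int.cast_natCast]
  rw [queryWidth, hM, hZ]
  have hdq : d = d.num / d.den := (Rat.num_div_den d).symm
  have hden : (0 : ℚ) < d.den := by exact_mod_cast d.den_pos
  have hnq : (0 : ℚ) < d.num := by exact_mod_cast hnum
  conv_rhs => rw [hdq]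
  field_simp

/-- `YF` on the input. [folklore] -/
theorem YF_input : YF (boolPair (codeOf I t d) y) = yardQ (codeOf I t d) := by simp [YF]

/-- `n ≤ |Y|`. [folklore] -/
theorem n_le_yard : I.n ≤ (yardQ (codeOf I t d)).length := by
  rw [length_yardQ]; nlinarith [n_le_length_codeOf I t d]

/-- `adjF` on the input: `⟨dpEnc det(−B), matCode (adj(−B))ᵀ⟩`. [folklore] -/
theorem adjF_input : adjF (boolPair (codeOf I t d) y) =
    boolPair (dpEnc (-I.basis).det) (matCode (fun k i : Fin I.n => (-I.basis).adjugate i k)) := by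
  rw [adjF, Function.comp_apply]
  simp only [fanoutFn_apply, YF_input, ncW_input, BnW_input]
  exact adjNegF_apply _ (n_le_yard I t d) I.basis (widthOK_codeOf I t d)

/-- Framed lists are coded lists (twin of the private `GapSVPVerifier.frames_eq_body`). [folklore] -/
theorem frames_eq_body' (l : List (List Bool)) : frames l = body l := by
  rw [body, foldr_boolPair_eq (fun c : List Bool => c) l, List.map_id']

/-- `iencW` on the input: the code `I.encode` of the basis part. [folklore] -/
theorem iencW_input : iencW (boolPair (codeOf I t d) y) = I.encode := by
  rw [iencW, fanoutFn_apply, ncW_input, I.encode_eq, ← boolPair_encodeNat, matrix_encode_eq, frames_eq_body', codeOf_eq]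
  simp only [Function.comp_apply, fstF_boolPair, sndF_boolPair]

/-- `instTF` on the input: the instance code of `⟨n, (adj(−B))ᵀ⟩`. [folklore] -/
theorem instTF_input : instTF (boolPair (codeOf I t d) y) = (queryInstance I).encode := by
  have e : (fun k i : Fin I.n => (-I.basis).adjugate i k) = ((-I.basis).adjugate)ᵀ :=
    funext fun k => funext fun i => (Matrix.transpose_apply _ _ _).symm
  rw [instTF, Function.comp_apply, fanoutFn_apply, iencW_input, Function.comp_apply, adjF_input, sndF_boolPair,
    outF_apply I (fun k i : Fin I.n => (-I.basis).adjugate i k), e, queryInstance]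

/-- `rqF` on the input (`d ≠ 0`): the lowest-terms code of the width. [folklore] -/
theorem rqF_input (hd : d ≠ 0) : rqF (boolPair (codeOf I t d) y) = qEnc (queryWidth I d) := by
  have hM : 0 < 100 * d.num.natAbs := Nat.mul_pos (by norm_num) (Int.natAbs_pos.2 (Rat.num_ne_zero.2 hd))
  rw [rqF, Function.comp_apply, fanoutFn_apply]
  simp only [numrF, denrF, Function.comp_apply, fanoutFn_apply, adjF_input, fstF_boolPair, zabsF_dpEnc, denW_input,
    natZF_apply, bitsToNat_encodeNat, zmulF_boolPair, ival_dpEnc, numW_input, prodFn_boolPair]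
  rw [qnormF_dpEnc _ hM, queryWidth]

/-- `ratF` on the input (`d ≠ 0`): the instance-format code of the width. [folklore] -/
theorem ratF_input (hd : d ≠ 0) : ratF (boolPair (codeOf I t d) y) = encodingRatBool.encode (queryWidth I d) := by
  rw [ratF, fanoutFn_apply, Function.comp_apply, Function.comp_apply, Function.comp_apply, rqF_input I t d y hd, qEnc,
    fstF_boolPair, sndF_boolPair, signMagOfZF_dpEnc]
  rfl

/-- **The value of the query writer on an instance code** (`d ≠ 0`): the code of the `GapSVP`-format
pair `(⟨n, (adj(−B))ᵀ⟩, |det(−B)| den(d) / (100 |num(d)|))`. [cite: Regev2009, Lemma 3.20 (proof)] -/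
theorem queryF_codeOf (hd : d ≠ 0) :
    queryF (codeOf I t d) = gapSVPInstanceEncoding.encode (queryInstance I, queryWidth I d) := by
  rw [queryF, Function.comp_apply, fanoutFn_apply, queryW, fanoutFn_apply, instTF_input, ratF_input I t d _ hd]
  rfl

end Value

end RegevQuery

end Literature.Algebra.EuclideanLattices

end
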